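import Summits.AtomisticToContinuum.HydrodynamicLimit.Theorems.OneFlightGossipEngineCollisionActivityTailsAbnormalActivityTaggedMajorant
import HarnessLib

/-!
# `CollisionActivityTails` (stmt-AtomisticToContinuum-13734), line `plaque-thinning-count-ld`, stub T₂a: the per-pair one-window
bound of the tagged half with TWO tagging thresholds (`stub_taggedPerPairTT`)

Helper file (`--supports stmt-AtomisticToContinuum-13734`) of the crux
`Summit.AtomisticToContinuum.HydrodynamicLimit.Theses.OneFlightGossipEngine.CollisionActivityTails`, skeleton line
`plaque-thinning-count-ld` (v12, two thresholds), registered stub T₂a `stub_taggedPerPairTT : TaggedPerPair₂`.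

This is the two-threshold PORT of the landed one-threshold per-pair bound `lintegral_tubePair_tagMajor_le` / `stub_taggedPerPair`
of `…AbnormalActivityTaggedMajorant` (p135132). There ONE threshold `y ≥ 200 A max(1, β⁻¹)` (`A = C (2π/β)^{3/2}`) served both the
count tag (`nearCount ≥ y K'`, which needs `y ≥ 100 A`, `lintegral_tubePair_countScale_le`) and the kinetic tag (`ballKinetic ≥ y K'`,
which needs `y ≥ 200 A β⁻¹`, `lintegral_tubePair_kineticScale_le`). Here the count series is run at a count threshold `yc ≥ 100 A` and
the kinetic series at a kinetic threshold `yk ≥ 200 A β⁻¹`, given separately; the enlarged-tag indicator `𝟙{TaggedPlus₂ yc yk δ K}` is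
dominated by the sum over the scales `K + j` of the count indicator at `yc` and the kinetic indicator at `yk`
(`taggedPlus₂Ind_le_tsum`), and the geometric sum is redone exactly as in the template:
`∫ tubePair (𝟙{cap} + 𝟙{TaggedPlus₂}) dμ ≤ (2^{-K} + Σ_j 5 · 2^{-(K+j)}) C² 4ε²h J = 11 · 2^{-K} C² 4ε²h J`
(`lintegral_tubePair_tagMajor₂_le`). The vocabulary `ScaleTag₂`, `TaggedPlus₂` and the statement `TaggedPerPair₂` are VERBATIM
copies of the skeleton's (over the same landed constants `nearCount`, `scaleRadius`, `ballKinetic`, `tubePair`, `fluxJ`,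
`LabelLawEnvelope`), so the skeleton bridges definitionally. This file lives in its own namespace and opens the tagged half's
`…CollisionActivityTailsAbnormalActivityTagged` for the template's helpers.

References: C. Cercignani, R. Illner, M. Pulvirenti, *The Mathematical Theory of Dilute Gases* (1994), §4.3, App. 4.A (collision
cylinders, collision sums along the hard-sphere flow); I. Gallagher, L. Saint-Raymond, B. Texier, *From Newton to Boltzmann* (2013),
Ch. 4. Elementary measure theory and bookkeeping; recorded here.
-/

noncomputable section

open MeasureTheory Set Filter Topology
open scoped ENNReal

namespace Summit.AtomisticToContinuum.HydrodynamicLimit.Theorems.CollisionActivityTailsTaggedPerPairTT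

open Literature.MathematicalPhysics.KineticTheory Literature.Analysis.FluidPDE
open Summit.AtomisticToContinuum.HydrodynamicLimit.Theorems.CollisionActivityTailsActivityDomination
  (Flow Cfg window act tdist nearCount)
-- the tagging vocabulary (w-abnormal's reduction file, landed):
open Summit.AtomisticToContinuum.HydrodynamicLimit.Theorems.CollisionActivityTailsAbnormalActivity (scaleRadius ballKinetic)
-- the label-set envelope vocabulary (the lead's plumbing, landed):
open Summit.AtomisticToContinuum.HydrodynamicLimit.Theorems.CollisionActivityTailsEnvelopePlumbing (LabelLawEnvelope)
-- the tagged half: collision-flux kernel, flux constant, cap / count / kinetic one-window bounds, measurability (landed, p135132 cone):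
open Summit.AtomisticToContinuum.HydrodynamicLimit.Theorems.CollisionActivityTailsAbnormalActivityTagged
  (tubePair fluxJ measurable_tubePair_cfg lintegral_tubePair_cap_le lintegral_tubePair_countScale_le
    lintegral_tubePair_kineticScale_le scaleRadius_mono measurable_nearCount_real measurable_ballKinetic measurableSet_cap)

/-! ## §8₂ The enlarged tag with two thresholds and the per-pair one-window bound -/

section MajorantTT

variable {N : ℕ}

/-- The count-or-kinetic tag at scale `K'` with two thresholds and the radius ENLARGED by `δ` (read at the grid time). -/
def ScaleTag₂ (yc yk δ : ℝ) (K' : ℕ) (w : Cfg N) (k : Fin (N + 1)) : Prop :=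
  yc * K' ≤ (nearCount w k (scaleRadius N K' + δ) : ℝ) ∨ yk * K' ≤ ballKinetic w k (scaleRadius N K' + δ)

/-- ENLARGED TAGGING (two thresholds) from the minimal scale `K`: some scale `K + j` carries the enlarged tag. -/
def TaggedPlus₂ (yc yk δ : ℝ) (K : ℕ) (w : Cfg N) (k : Fin (N + 1)) : Prop := ∃ j : ℕ, ScaleTag₂ yc yk δ (K + j) w k

open scoped Classical in
/-- The two-threshold enlarged-tag indicator is at most the sum over the scales of the count indicator (threshold `yc`) and the
kinetic indicator (threshold `yk`). -/
theorem taggedPlus₂Ind_le_tsum (yc yk δ : ℝ) (K : ℕ) (w : Cfg N) (k : Fin (N + 1)) :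
    (if TaggedPlus₂ yc yk δ K w k then (1 : ℝ≥0∞) else 0) ≤
      ∑' j : ℕ, ((if yc * (K + j : ℕ) ≤ (nearCount w k (scaleRadius N (K + j) + δ) : ℝ) then (1 : ℝ≥0∞) else 0) +
        (if yk * (K + j : ℕ) ≤ ballKinetic w k (scaleRadius N (K + j) + δ) then (1 : ℝ≥0∞) else 0)) := by
  -- adapted from `taggedPlusInd_le_tsum` (one threshold) of `…AbnormalActivityTaggedMajorant`
  split_ifs with h
  · obtain ⟨j, hj⟩ := h
    refine le_trans ?_ (ENNReal.le_tsum j)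
    rcases hj with hc | hk
    · rw [if_pos hc]; exact le_self_add
    · rw [if_pos hk]; exact le_add_self
  · exact bot_le

open scoped Classical in
/-- **THE PER-PAIR ONE-WINDOW BOUND OF THE TAGGED HALF, two thresholds** under a label-set envelope: with `A = C(2π/β)^{3/2} ≥ 1`,
count threshold `yc ≥ 100 A`, kinetic threshold `yk ≥ 200 A β⁻¹`, minimal scale `K ≥ 1`, enlargement `0 ≤ δ ≤ R_1`, and a speed cap
`U ≥ 0` so large that `(N+1)(1 + C c') e^{-λU²} ≤ 2^{-K}`:
`∫ tubePair(w_k, w_l) (𝟙{cap} + 𝟙{TaggedPlus₂}) dμ ≤ 11 · 2^{-K} · C² · 4ε²h · J`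
(cap `2^{-K}`; scales `K + j`: count at `yc` `4 · 2^{-(K+j)}` + kinetic at `yk` `2^{-(K+j)}`, geometric sum `= 10 · 2^{-K}`). -/
theorem lintegral_tubePair_tagMajor₂_le {μ : Measure (Cfg N)} {C β : ℝ} (hC : 0 ≤ C) (hβ : 0 < β)
    (hμ : LabelLawEnvelope μ C β) {k l : Fin (N + 1)} (hkl : k ≠ l) {S : V3 → Set V3}
    (hSm : MeasurableSet {q : V3 × V3 | q.1 ∈ S q.2}) {ε h : ℝ} (hεh : 0 ≤ 4 * ε ^ 2 * h)
    (hSvol : ∀ u, volume (S u) ≤ ENNReal.ofReal (4 * ε ^ 2 * h * ‖u‖))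
    (hA : 1 ≤ C * (2 * Real.pi / β) ^ (3 / 2 : ℝ)) {yc : ℝ} (hyc : 100 * (C * (2 * Real.pi / β) ^ (3 / 2 : ℝ)) ≤ yc)
    {yk : ℝ} (hyk : 200 * (C * (2 * Real.pi / β) ^ (3 / 2 : ℝ)) * β⁻¹ ≤ yk)
    {K : ℕ} (hK : 1 ≤ K) {δ : ℝ} (hδ : 0 ≤ δ) (hδR : δ ≤ scaleRadius N 1) {U : ℝ} (hU : 0 ≤ U)
    (hUcap : ((N : ℝ≥0∞) + 1) * (1 + ENNReal.ofReal C * ENNReal.ofReal ((2 * Real.pi / (β / 2)) ^ (3 / 2 : ℝ))) *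
      ENNReal.ofReal (Real.exp (-(β / 4 * U ^ 2))) ≤ 2⁻¹ ^ K) :
    ∫⁻ w, tubePair S (w k) (w l) *
        ((if ∃ j, U < ‖(w j).2‖ then 1 else 0) + (if TaggedPlus₂ yc yk δ K w k then 1 else 0)) ∂μ ≤
      11 * 2⁻¹ ^ K * (ENNReal.ofReal (C ^ 2) * (ENNReal.ofReal (4 * ε ^ 2 * h) * fluxJ β)) := by
  -- adapted from `lintegral_tubePair_tagMajor_le` (one threshold) of `…AbnormalActivityTaggedMajorant`: the count series runs at
  -- `yc`, the kinetic series at `yk`; cap, scales and geometric sum unchanged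
  classical
  set Q : ℝ≥0∞ := ENNReal.ofReal (C ^ 2) * (ENNReal.ofReal (4 * ε ^ 2 * h) * fluxJ β) with hQ
  have htw := measurable_tubePair_cfg hSm k l (N := N)
  -- the cap
  have hcap : ∫⁻ w, tubePair S (w k) (w l) * (if ∃ j, U < ‖(w j).2‖ then 1 else 0) ∂μ ≤ 2⁻¹ ^ K * Q := by
    refine (lintegral_tubePair_cap_le hC hβ hμ hkl hSm hεh hSvol hU).trans ?_
    calc ((N : ℝ≥0∞) + 1) * (ENNReal.ofReal (C ^ 2) * max 1 (ENNReal.ofReal C * ENNReal.ofReal ((2 * Real.pi / (β / 2)) ^ (3 / 2 : ℝ))) *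
          ENNReal.ofReal (Real.exp (-(β / 4 * U ^ 2))) * (ENNReal.ofReal (4 * ε ^ 2 * h) * fluxJ β))
        ≤ ((N : ℝ≥0∞) + 1) * (ENNReal.ofReal (C ^ 2) * (1 + ENNReal.ofReal C * ENNReal.ofReal ((2 * Real.pi / (β / 2)) ^ (3 / 2 : ℝ))) *
          ENNReal.ofReal (Real.exp (-(β / 4 * U ^ 2))) * (ENNReal.ofReal (4 * ε ^ 2 * h) * fluxJ β)) := by
          gcongr
          exact max_le le_self_add le_add_self
      _ = ((N : ℝ≥0∞) + 1) * (1 + ENNReal.ofReal C * ENNReal.ofReal ((2 * Real.pi / (β / 2)) ^ (3 / 2 : ℝ))) *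
          ENNReal.ofReal (Real.exp (-(β / 4 * U ^ 2))) * Q := by rw [hQ]; ring
      _ ≤ 2⁻¹ ^ K * Q := by gcongr
  -- the scales: count indicator at `yc`, kinetic indicator at `yk`
  set cI : ℕ → Cfg N → ℝ≥0∞ := fun j w =>
    if yc * (K + j : ℕ) ≤ (nearCount w k (scaleRadius N (K + j) + δ) : ℝ) then 1 else 0 with hcI
  set kI : ℕ → Cfg N → ℝ≥0∞ := fun j w =>
    if yk * (K + j : ℕ) ≤ ballKinetic w k (scaleRadius N (K + j) + δ) then 1 else 0 with hkI
  have hcIm : ∀ j, Measurable (cI j) := fun j =>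
    Measurable.ite (measurableSet_le measurable_const (measurable_nearCount_real k _)) measurable_const measurable_const
  have hkIm : ∀ j, Measurable (kI j) := fun j =>
    Measurable.ite (measurableSet_le measurable_const (measurable_ballKinetic k _)) measurable_const measurable_const
  have hscale : ∀ j : ℕ, ∫⁻ w, tubePair S (w k) (w l) * (cI j w + kI j w) ∂μ ≤ 5 * 2⁻¹ ^ (K + j) * Q := by
    intro j
    have hKj : 1 ≤ K + j := le_add_right hK
    have hδR' : δ ≤ scaleRadius N (K + j) := hδR.trans (scaleRadius_mono N hKj)
    have h1 := lintegral_tubePair_countScale_le hC hβ hμ hkl hSm hεh hSvol hA hyc hKj hδ hδR'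
    have h2 := lintegral_tubePair_kineticScale_le hC hβ hμ hkl hSm hεh hSvol hA hyk hKj hδ hδR'
    calc ∫⁻ w, tubePair S (w k) (w l) * (cI j w + kI j w) ∂μ
        = ∫⁻ w, tubePair S (w k) (w l) * cI j w ∂μ + ∫⁻ w, tubePair S (w k) (w l) * kI j w ∂μ := by
          simp_rw [mul_add]
          exact lintegral_add_left (htw.mul (hcIm j)) _
      _ ≤ 4 * 2⁻¹ ^ (K + j) * Q + 2⁻¹ ^ (K + j) * Q := add_le_add h1 h2
      _ = 5 * 2⁻¹ ^ (K + j) * Q := by ring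
  have htag : ∫⁻ w, tubePair S (w k) (w l) * (if TaggedPlus₂ yc yk δ K w k then 1 else 0) ∂μ ≤ 10 * 2⁻¹ ^ K * Q := by
    calc ∫⁻ w, tubePair S (w k) (w l) * (if TaggedPlus₂ yc yk δ K w k then 1 else 0) ∂μ
        ≤ ∫⁻ w, ∑' j, tubePair S (w k) (w l) * (cI j w + kI j w) ∂μ := by
          refine lintegral_mono fun w => ?_
          rw [ENNReal.tsum_mul_left]
          exact mul_le_mul' le_rfl (taggedPlus₂Ind_le_tsum yc yk δ K w k)
      _ = ∑' j, ∫⁻ w, tubePair S (w k) (w l) * (cI j w + kI j w) ∂μ :=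
          lintegral_tsum fun j => (htw.mul ((hcIm j).add (hkIm j))).aemeasurable
      _ ≤ ∑' j, 5 * 2⁻¹ ^ (K + j) * Q := ENNReal.tsum_le_tsum hscale
      _ = 5 * 2⁻¹ ^ K * Q * ∑' j : ℕ, (2⁻¹ : ℝ≥0∞) ^ j := by
          rw [← ENNReal.tsum_mul_left]; congr 1; funext j; rw [pow_add]; ring
      _ = 10 * 2⁻¹ ^ K * Q := by
          rw [ENNReal.tsum_geometric, ENNReal.one_sub_inv_two, inv_inv]; ring
  -- total
  calc ∫⁻ w, tubePair S (w k) (w l) * ((if ∃ j, U < ‖(w j).2‖ then 1 else 0) + (if TaggedPlus₂ yc yk δ K w k then 1 else 0)) ∂μ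
      = ∫⁻ w, tubePair S (w k) (w l) * (if ∃ j, U < ‖(w j).2‖ then 1 else 0) ∂μ +
          ∫⁻ w, tubePair S (w k) (w l) * (if TaggedPlus₂ yc yk δ K w k then 1 else 0) ∂μ := by
        simp_rw [mul_add]
        exact lintegral_add_left (htw.mul (Measurable.ite (measurableSet_cap U) measurable_const measurable_const)) _
    _ ≤ 2⁻¹ ^ K * Q + 10 * 2⁻¹ ^ K * Q := add_le_add hcap htag
    _ = 11 * 2⁻¹ ^ K * Q := by ring

/-! ## The registered statement (VERBATIM copy of the skeleton's `TaggedPerPair₂`) and the stub -/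

open scoped Classical in
/-- **STUB T₂a — THE PER-PAIR ONE-WINDOW BOUND OF THE TAGGED HALF, two thresholds** (closable: the landed `lintegral_tubePair_tagMajor_le`
of `…AbnormalActivityTaggedMajorant` p135132 with the count series run at `yc ≥ 100 A` (`lintegral_tubePair_countScale_le`) and the kinetic
series at `yk ≥ 200 A β⁻¹` (`lintegral_tubePair_kineticScale_le`), cap `2^{-K}`, geometric sum `10 · 2^{-K}`). -/
def TaggedPerPair₂ : Prop :=
  ∀ {N : ℕ} {μ : Measure (Cfg N)} {C β : ℝ}, 0 ≤ C → 0 < β → LabelLawEnvelope μ C β →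
    ∀ {k l : Fin (N + 1)}, k ≠ l → ∀ {S : V3 → Set V3}, MeasurableSet {q : V3 × V3 | q.1 ∈ S q.2} →
    ∀ {ε h : ℝ}, 0 ≤ 4 * ε ^ 2 * h → (∀ u, volume (S u) ≤ ENNReal.ofReal (4 * ε ^ 2 * h * ‖u‖)) →
    1 ≤ C * (2 * Real.pi / β) ^ (3 / 2 : ℝ) →
    ∀ {yc : ℝ}, 100 * (C * (2 * Real.pi / β) ^ (3 / 2 : ℝ)) ≤ yc →
    ∀ {yk : ℝ}, 200 * (C * (2 * Real.pi / β) ^ (3 / 2 : ℝ)) * β⁻¹ ≤ yk →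
    ∀ {K : ℕ}, 1 ≤ K → ∀ {δ : ℝ}, 0 ≤ δ → δ ≤ scaleRadius N 1 → ∀ {U : ℝ}, 0 ≤ U →
    ((N : ℝ≥0∞) + 1) * (1 + ENNReal.ofReal C * ENNReal.ofReal ((2 * Real.pi / (β / 2)) ^ (3 / 2 : ℝ))) *
        ENNReal.ofReal (Real.exp (-(β / 4 * U ^ 2))) ≤ 2⁻¹ ^ K →
    ∫⁻ w, tubePair S (w k) (w l) *
        ((if ∃ j, U < ‖(w j).2‖ then 1 else 0) + (if TaggedPlus₂ yc yk δ K w k then 1 else 0)) ∂μ ≤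
      11 * 2⁻¹ ^ K * (ENNReal.ofReal (C ^ 2) * (ENNReal.ofReal (4 * ε ^ 2 * h) * fluxJ β))

/-- **STUB T₂a (line `plaque-thinning-count-ld`), proved.** The per-pair one-window bound of the tagged half with two tagging
thresholds under a label-set law envelope (`lintegral_tubePair_tagMajor₂_le`, closed form). -/
theorem stub_taggedPerPairTT : TaggedPerPair₂ := by
  intro N μ C β hC hβ hμ k l hkl S hSm ε h hεh hSvol hA yc hyc yk hyk K hK δ hδ hδR U hU hUcap
  exact lintegral_tubePair_tagMajor₂_le hC hβ hμ hkl hSm hεh hSvol hA hyc hyk hK hδ hδR hU hUcap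

end MajorantTT

end Summit.AtomisticToContinuum.HydrodynamicLimit.Theorems.CollisionActivityTailsTaggedPerPairTT

end
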